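import Mathlib.MeasureTheory.Function.JacobianOneDim
import Mathlib.Analysis.SpecialFunctions.Log.Deriv
import Literature.Analysis.FluidPDE.DynamicRescalingBlowup
import HarnessLib

/-!
# The Beale–Kato–Majda integral under dynamic rescaling, and the modulation parameter `λ`
of Elgindi–Ghoul–Masmoudi

Topic `Literature/Analysis/FluidPDE`. Support file (theorems only, no definitions, no named
facts) on the decomposition path of the named fact
`Literature.Analysis.FluidPDE.ElgindiGhoulMasmoudi2021_finiteEnergyBlowup` (`ElgindiBlowup.lean`;
[ElgindiGhoulMasmoudi2021] = Elgindi–Ghoul–Masmoudi, Camb. J. Math. 9 (2021), arXiv:1910.14071,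
§1.3 Theorem 1). It proves the real-analysis bookkeeping by which the conclusion of the
*stability theorem* in self-similar variables ([ElgindiGhoulMasmoudi2021] §2.5 Theorem 2, p. 9 of
the held text: a global solution of the modulated system with
`|μ_s| + |λ_s/λ + 1| + 𝓔(s) ≤ C 𝓔₀ e^{−κs}` for all `s ≥ 0`) is turned into the blow-up clause
*as printed* in Theorem 1, `lim_{t → T_*} ∫₀ᵗ |ω(s)|_{L^∞} ds = +∞` — a passage the paper leaves
to the reader (p. 9: "the following stability theorem from which Theorem 1 and its Corollary
follow"; Corollary 2.2 with Remark 2.3: "this corollary follows directly from Theorem 2 in view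
of the scaling laws (2.13)").

## The printed setting ([ElgindiGhoulMasmoudi2021] §2.3, (2.13), p. 8)

Physical and self-similar times are related by `ds/dt = 1/λ`, i.e. `t(s) = ∫₀ˢ λ(σ) dσ`, and the
vorticity is `Ω(R, t, θ) = λ⁻¹ W(μR/λ^{1+δ}, s, θ)`, so that `‖ω(t(s))‖_{L^∞} = λ(s)⁻¹ ‖W(s)‖_{L^∞}`.
In the tree's vocabulary (`DynamicRescalingBlowup.lean`, written for Chen–Hou's `C_ω(τ)`):
`t = Fluid.rescaledTime λ`, `T_* = t(∞) = Fluid.blowupTime λ`.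

## What is proved here

* **The BKM integral along the rescaled time** (change of variables `t = t(σ)`, `dt = λ dσ`):
  `∫_{(0, t(τ))} N = ∫_{(0, τ)} λ(σ) N(t(σ)) dσ` for any `[0, ∞]`-valued size functional `N`
  (`lintegral_Ioo_rescaledTime`); hence a rescaled lower bound `λ(σ) N(t(σ)) ≥ m > 0`
  (nontriviality of the rescaled profile, `‖W(s)‖_∞ ≥ m`) gives `∫_{(0,t(τ))} N ≥ m τ` and, when
  `T_* = ∫₀^∞ λ < ∞`, the printed form of blow-up `∫_{(0,t)} N → ∞` as `t ↑ T_*`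
  (`tendsto_lintegral_Ioo_nhdsLT_blowupTime`). This complements the `limsup` form
  `Fluid.vorticityBlowsUpOnAt_of_rescaling` of `DynamicRescalingBlowup.lean`.
* **The modulation parameter.** From the estimate of Theorem 2 in the weak form
  `|λ_s/λ + 1| ≤ η < 1` (`s > 0`): two-sided exponential bounds
  `λ(0) e^{−(1+η)s} ≤ λ(s) ≤ λ(0) e^{−(1−η)s}` (`le_mul_exp_of_modulation`,
  `mul_exp_le_of_modulation`), integrability of `λ` on `(0, ∞)` and the bounds
  `λ(0)/(1+η) ≤ T_* ≤ λ(0)/(1−η)` on the blow-up time (`blowupTime_le_of_modulation`,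
  `le_blowupTime_of_modulation`) — the content of "`T_* ≈ 1`" in Corollary 2.2 for `λ(0) = 1`
  and `η = C𝓔₀` small — and the packaged statement `tendsto_lintegral_of_modulation`:
  Theorem 2's estimate plus nontriviality of the rescaled vorticity give Theorem 1's
  `lim_{t ↑ T_*} ∫₀ᵗ ‖ω‖_∞ = ∞`.

## Faithfulness notes

* Corollary 2.2 prints "`λ(s) exp(s) → 1/T_* ≈ 1`" and "`(T_*/(T_* − t)) λ(t) → 1`". With the
  normalisation (2.13) the exactly self-similar solution has `λ(s) = T_* e^{−s}`, so these
  displays hold up to the factor `T_* ≈ 1`; only the `≈`-content (two-sided bounds with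
  constants `1 ± η`) is proved here, nothing is asserted about the literal limits.
* Hypotheses on `λ` are continuity and positivity on `ℝ` (a parameter given on `s ≥ 0` extends
  by a constant to `s < 0`; only `s ≥ 0` enters `t` and `T_*`, as in `DynamicRescalingBlowup`),
  differentiability and the modulation bound at `s > 0` only.

Mathlib/tree search (`lean search 'rescaledTime|blowupTime|lintegral_image'`): the tree has the
rescaled time and the `limsup` mechanism (`DynamicRescalingBlowup.lean`) but not the integral form
nor the log-derivative bounds. Used from Mathlib: `lintegral_image_eq_lintegral_abs_deriv_mul`
(one-dimensional change of variables), `intermediate_value_Ioo`, `antitoneOn_of_deriv_nonpos`,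
`monotoneOn_of_deriv_nonneg`, `HasDerivAt.log`, `exp_neg_integrableOn_Ioi`, `integral_exp_mul_Ioi`,
`ENNReal.tendsto_nhds_top_iff_nnreal`, `Continuous.integral_hasStrictDerivAt`.
-/

noncomputable section

open MeasureTheory Set Filter intervalIntegral
open _root_.Topology
open scoped NNReal ENNReal

namespace Literature.Analysis.FluidPDE

/-! ### The BKM integral along the rescaled time -/

section Integral

variable {C : ℝ → ℝ}

/-- The rescaled time `t(τ) = ∫₀^τ C` has derivative `C(τ)` (fundamental theorem of calculus for a
continuous factor). [folklore] -/
theorem hasDerivAt_rescaledTime (hC : Continuous C) (τ : ℝ) :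
    HasDerivAt (rescaledTime C) (C τ) τ := by
  have h : rescaledTime C = fun u => ∫ s in (0 : ℝ)..u, C s := rfl
  rw [h]
  exact (hC.integral_hasStrictDerivAt 0 τ).hasDerivAt

/-- A continuous, strictly increasing rescaled time maps the rescaled-time interval `(a, b)` onto
the physical-time interval `(t(a), t(b))` (intermediate value theorem). [folklore] -/
theorem image_rescaledTime_Ioo (hC : Continuous C) (hpos : ∀ τ, 0 < C τ) {a b : ℝ} (hab : a ≤ b) :
    rescaledTime C '' Ioo a b = Ioo (rescaledTime C a) (rescaledTime C b) := by
  refine Subset.antisymm ?_ (intermediate_value_Ioo hab (continuous_rescaledTime hC).continuousOn)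
  rintro _ ⟨τ, hτ, rfl⟩
  exact ⟨strictMono_rescaledTime hC hpos hτ.1, strictMono_rescaledTime hC hpos hτ.2⟩

/-- **The Beale–Kato–Majda integral along the rescaled time.** For a continuous positive factor
`C` (`dt = C dσ`) and any `[0, ∞]`-valued functional `N` of physical time (e.g.
`N(t) = ‖ω(t)‖_{L^∞}`), `∫_{(0, t(τ))} N(t) dt = ∫_{(0, τ)} C(σ) N(t(σ)) dσ` for `τ ≥ 0`
(one-dimensional change of variables along the strictly increasing `C¹` map `t`;
[ElgindiGhoulMasmoudi2021] (2.13): `ds/dt = 1/λ`). [folklore] -/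
theorem lintegral_Ioo_rescaledTime (hC : Continuous C) (hpos : ∀ τ, 0 < C τ) (N : ℝ → ℝ≥0∞)
    {τ : ℝ} (hτ : 0 ≤ τ) :
    ∫⁻ t in Ioo 0 (rescaledTime C τ), N t =
      ∫⁻ σ in Ioo 0 τ, ENNReal.ofReal (C σ) * N (rescaledTime C σ) := by
  have himage := image_rescaledTime_Ioo hC hpos hτ
  rw [rescaledTime_zero] at himage
  rw [← himage, lintegral_image_eq_lintegral_abs_deriv_mul measurableSet_Ioo
    (fun σ _ => (hasDerivAt_rescaledTime hC σ).hasDerivWithinAt)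
    (strictMono_rescaledTime hC hpos).injective.injOn]
  simp_rw [abs_of_pos (hpos _)]

/-- **Linear growth of the BKM integral in rescaled time.** If the rescaled size stays above
`m` — `m ≤ C(σ) N(t(σ))` for `σ > 0` (for [ElgindiGhoulMasmoudi2021]: `‖W(s)‖_{L^∞} =
λ(s) ‖ω(t(s))‖_{L^∞} ≥ m`) — then `∫_{(0, t(τ))} N ≥ m τ` for `τ ≥ 0`. [folklore] -/
theorem mul_le_lintegral_Ioo_rescaledTime (hC : Continuous C) (hpos : ∀ τ, 0 < C τ)
    {N : ℝ → ℝ≥0∞} {m : ℝ≥0∞} (hN : ∀ σ, 0 < σ → m ≤ ENNReal.ofReal (C σ) * N (rescaledTime C σ))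
    {τ : ℝ} (hτ : 0 ≤ τ) :
    m * ENNReal.ofReal τ ≤ ∫⁻ t in Ioo 0 (rescaledTime C τ), N t := by
  rw [lintegral_Ioo_rescaledTime hC hpos N hτ]
  calc m * ENNReal.ofReal τ = ∫⁻ _σ in Ioo 0 τ, m := by
        rw [setLIntegral_const, Real.volume_Ioo, sub_zero]
    _ ≤ ∫⁻ σ in Ioo 0 τ, ENNReal.ofReal (C σ) * N (rescaledTime C σ) :=
        setLIntegral_mono' measurableSet_Ioo fun σ hσ => hN σ hσ.1

/-- **Blow-up in the printed Beale–Kato–Majda form from dynamic rescaling.** Let the factor `C`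
(`= λ` for [ElgindiGhoulMasmoudi2021], `= C_ω` for Chen–Hou) be continuous, positive and
integrable on `(0, ∞)`, so that the physical solution lives on `[0, T)`, `T = t(∞) < ∞`, and let
the rescaled size stay above `m > 0`: `m ≤ C(σ) N(t(σ))` for `σ > 0`. Then
`∫_{(0, t)} N → +∞` as `t ↑ T` — the form `lim_{t → T_*} ∫₀ᵗ |ω(s)|_{L^∞} ds = +∞` in which
[ElgindiGhoulMasmoudi2021] Thm 1 and [Elgindi2021] Thm 1 state blow-up (the integral is monotone
in `t` and exceeds `m τ` at `t = t(τ)`). [folklore] -/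
theorem tendsto_lintegral_Ioo_nhdsLT_blowupTime (hC : Continuous C) (hpos : ∀ τ, 0 < C τ)
    (hint : IntegrableOn C (Ioi 0)) {N : ℝ → ℝ≥0∞} {m : ℝ≥0∞} (hm : m ≠ 0)
    (hN : ∀ σ, 0 < σ → m ≤ ENNReal.ofReal (C σ) * N (rescaledTime C σ)) :
    Tendsto (fun t => ∫⁻ s in Ioo 0 t, N s) (𝓝[<] (blowupTime C)) (𝓝 ∞) := by
  rw [ENNReal.tendsto_nhds_top_iff_nnreal]
  intro M
  have h1 : Tendsto (fun τ : ℝ => m * ENNReal.ofReal τ) atTop (𝓝 (m * ∞)) :=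
    ENNReal.Tendsto.const_mul ENNReal.tendsto_ofReal_atTop (Or.inl ENNReal.top_ne_zero)
  rw [ENNReal.mul_top hm] at h1
  obtain ⟨τ, hτ0, hMτ⟩ :=
    ((eventually_ge_atTop (0 : ℝ)).and (h1.eventually (lt_mem_nhds ENNReal.coe_lt_top))).exists
  have hlt := rescaledTime_lt_blowupTime hC hpos hint τ
  filter_upwards [Ioo_mem_nhdsLT hlt] with t ht
  calc (M : ℝ≥0∞) < m * ENNReal.ofReal τ := hMτ
    _ ≤ ∫⁻ s in Ioo 0 (rescaledTime C τ), N s := mul_le_lintegral_Ioo_rescaledTime hC hpos hN hτ0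
    _ ≤ ∫⁻ s in Ioo 0 t, N s := lintegral_mono_set (Ioo_subset_Ioo_right ht.1.le)

end Integral

/-! ### The modulation parameter `λ` of [ElgindiGhoulMasmoudi2021], Theorem 2 -/

section Modulation

variable {lam lam' : ℝ → ℝ} {η : ℝ}

/-- **Exponential decay of `λ` from the modulation estimate.** If `λ > 0` is continuous on
`[0, ∞)`, differentiable on `(0, ∞)` and `|λ_s/λ + 1| ≤ η` there (the estimate
`|λ_s/λ + 1| ≤ C𝓔₀e^{−κs} ≤ C𝓔₀ =: η` of [ElgindiGhoulMasmoudi2021] §2.5 Thm 2, p. 9), then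
`λ(s) ≤ λ(0) e^{−(1−η)s}` for `s ≥ 0`: the function `log λ(s) + (1 − η)s` has derivative
`λ_s/λ + 1 − η ≤ 0`. [cite: ElgindiGhoulMasmoudi2021, §2.5 Thm 2 and Cor 2.2 (p. 9)] -/
theorem le_mul_exp_of_modulation (hcont : ContinuousOn lam (Ici 0)) (hpos : ∀ s, 0 ≤ s → 0 < lam s)
    (hderiv : ∀ s, 0 < s → HasDerivAt lam (lam' s) s)
    (hη : ∀ s, 0 < s → |lam' s / lam s + 1| ≤ η) {s : ℝ} (hs : 0 ≤ s) :
    lam s ≤ lam 0 * Real.exp (-(1 - η) * s) := by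
  set g : ℝ → ℝ := fun s => Real.log (lam s) + (1 - η) * s with hg
  have hg_cont : ContinuousOn g (Ici 0) :=
    (hcont.log fun s hs => (hpos s hs).ne').add (continuous_const.mul continuous_id).continuousOn
  have hg_deriv : ∀ s, 0 < s → HasDerivAt g (lam' s / lam s + (1 - η)) s := fun s hs => by
    have h1 : HasDerivAt (fun s => Real.log (lam s)) (lam' s / lam s) s :=
      (hderiv s hs).log (hpos s hs.le).ne'
    have h2 : HasDerivAt (fun s : ℝ => (1 - η) * s) (1 - η) s := by
      simpa using (hasDerivAt_id s).const_mul (1 - η)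
    exact h1.add h2
  have hanti : AntitoneOn g (Ici 0) := by
    refine antitoneOn_of_deriv_nonpos (convex_Ici 0) hg_cont ?_ ?_
    · intro s hs
      rw [interior_Ici] at hs
      exact (hg_deriv s hs).differentiableAt.differentiableWithinAt
    · intro s hs
      rw [interior_Ici] at hs
      rw [(hg_deriv s hs).deriv]
      have h := (abs_le.1 (hη s hs)).2
      linarith
  have hle : g s ≤ g 0 := hanti (mem_Ici.2 le_rfl) (mem_Ici.2 hs) hs
  simp only [hg, mul_zero, add_zero] at hle
  calc lam s = Real.exp (Real.log (lam s)) := (Real.exp_log (hpos s hs)).symm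
    _ ≤ Real.exp (Real.log (lam 0) + -(1 - η) * s) := Real.exp_le_exp.2 (by linarith)
    _ = lam 0 * Real.exp (-(1 - η) * s) := by rw [Real.exp_add, Real.exp_log (hpos 0 le_rfl)]

/-- **Exponential lower bound for `λ` from the modulation estimate**: under the hypotheses of
`le_mul_exp_of_modulation`, `λ(0) e^{−(1+η)s} ≤ λ(s)` for `s ≥ 0` (the function
`log λ(s) + (1 + η)s` has derivative `λ_s/λ + 1 + η ≥ 0`). [cite: ElgindiGhoulMasmoudi2021, §2.5 Thm 2 and Cor 2.2 (p. 9)] -/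
theorem mul_exp_le_of_modulation (hcont : ContinuousOn lam (Ici 0)) (hpos : ∀ s, 0 ≤ s → 0 < lam s)
    (hderiv : ∀ s, 0 < s → HasDerivAt lam (lam' s) s)
    (hη : ∀ s, 0 < s → |lam' s / lam s + 1| ≤ η) {s : ℝ} (hs : 0 ≤ s) :
    lam 0 * Real.exp (-(1 + η) * s) ≤ lam s := by
  set g : ℝ → ℝ := fun s => Real.log (lam s) + (1 + η) * s with hg
  have hg_cont : ContinuousOn g (Ici 0) :=
    (hcont.log fun s hs => (hpos s hs).ne').add (continuous_const.mul continuous_id).continuousOn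
  have hg_deriv : ∀ s, 0 < s → HasDerivAt g (lam' s / lam s + (1 + η)) s := fun s hs => by
    have h1 : HasDerivAt (fun s => Real.log (lam s)) (lam' s / lam s) s :=
      (hderiv s hs).log (hpos s hs.le).ne'
    have h2 : HasDerivAt (fun s : ℝ => (1 + η) * s) (1 + η) s := by
      simpa using (hasDerivAt_id s).const_mul (1 + η)
    exact h1.add h2
  have hmono : MonotoneOn g (Ici 0) := by
    refine monotoneOn_of_deriv_nonneg (convex_Ici 0) hg_cont ?_ ?_
    · intro s hs
      rw [interior_Ici] at hs
      exact (hg_deriv s hs).differentiableAt.differentiableWithinAt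
    · intro s hs
      rw [interior_Ici] at hs
      rw [(hg_deriv s hs).deriv]
      have h := (abs_le.1 (hη s hs)).1
      linarith
  have hle : g 0 ≤ g s := hmono (mem_Ici.2 le_rfl) (mem_Ici.2 hs) hs
  simp only [hg, mul_zero, add_zero] at hle
  calc lam 0 * Real.exp (-(1 + η) * s) = Real.exp (Real.log (lam 0) + -(1 + η) * s) := by
        rw [Real.exp_add, Real.exp_log (hpos 0 le_rfl)]
    _ ≤ Real.exp (Real.log (lam s)) := Real.exp_le_exp.2 (by linarith)
    _ = lam s := Real.exp_log (hpos s hs)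

/-- **`T_* = ∫₀^∞ λ < ∞`**: under the modulation estimate with `η < 1`, `λ` is integrable on
`(0, ∞)` (comparison with `λ(0) e^{−(1−η)s}`), so the physical solution of
[ElgindiGhoulMasmoudi2021] Thm 2 lives on the bounded interval `[0, T_*)`, `T_* = t(∞)`
(Cor 2.2: "there exists `T_*`"). [cite: ElgindiGhoulMasmoudi2021, §2.5 Cor 2.2 (p. 9)] -/
theorem integrableOn_Ioi_of_modulation (hcont : Continuous lam) (hpos : ∀ s, 0 < lam s)
    (hderiv : ∀ s, 0 < s → HasDerivAt lam (lam' s) s) (hη1 : η < 1)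
    (hη : ∀ s, 0 < s → |lam' s / lam s + 1| ≤ η) : IntegrableOn lam (Ioi 0) := by
  have h1η : 0 < 1 - η := by linarith
  refine Integrable.mono' ((exp_neg_integrableOn_Ioi 0 h1η).integrable.const_mul (lam 0))
    hcont.aestronglyMeasurable ?_
  refine ae_restrict_of_forall_mem measurableSet_Ioi fun s hs => ?_
  rw [Real.norm_of_nonneg (hpos s).le]
  exact le_mul_exp_of_modulation hcont.continuousOn (fun s _ => hpos s) hderiv hη (le_of_lt hs)

/-- **`T_* ≤ λ(0)/(1 − η)`** (for `λ(0) = 1` and `η = C𝓔₀` small: `T_* ⪅ 1`, the upper half of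
"`T_* ≈ 1`" in [ElgindiGhoulMasmoudi2021] Cor 2.2). [cite: ElgindiGhoulMasmoudi2021, §2.5 Cor 2.2 (p. 9)] -/
theorem blowupTime_le_of_modulation (hcont : Continuous lam) (hpos : ∀ s, 0 < lam s)
    (hderiv : ∀ s, 0 < s → HasDerivAt lam (lam' s) s) (hη1 : η < 1)
    (hη : ∀ s, 0 < s → |lam' s / lam s + 1| ≤ η) : blowupTime lam ≤ lam 0 / (1 - η) := by
  have h1η : 0 < 1 - η := by linarith
  have hint := integrableOn_Ioi_of_modulation hcont hpos hderiv hη1 hη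
  have hint' : IntegrableOn (fun s => lam 0 * Real.exp (-(1 - η) * s)) (Ioi 0) :=
    (exp_neg_integrableOn_Ioi 0 h1η).integrable.const_mul (lam 0)
  calc blowupTime lam ≤ ∫ s in Ioi (0 : ℝ), lam 0 * Real.exp (-(1 - η) * s) :=
        setIntegral_mono_on hint hint' measurableSet_Ioi fun s hs =>
          le_mul_exp_of_modulation hcont.continuousOn (fun s _ => hpos s) hderiv hη (le_of_lt hs)
    _ = lam 0 / (1 - η) := by
        rw [MeasureTheory.integral_const_mul, integral_exp_mul_Ioi (by linarith) 0, mul_zero, Real.exp_zero]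
        field_simp

/-- **`λ(0)/(1 + η) ≤ T_*`** (the lower half of "`T_* ≈ 1`" in [ElgindiGhoulMasmoudi2021] Cor 2.2:
`T_* = ∫₀^∞ λ ≥ λ(0) ∫₀^∞ e^{−(1+η)s} ds`). [cite: ElgindiGhoulMasmoudi2021, §2.5 Cor 2.2 (p. 9)] -/
theorem le_blowupTime_of_modulation (hcont : Continuous lam) (hpos : ∀ s, 0 < lam s)
    (hderiv : ∀ s, 0 < s → HasDerivAt lam (lam' s) s) (hη0 : 0 ≤ η) (hη1 : η < 1)
    (hη : ∀ s, 0 < s → |lam' s / lam s + 1| ≤ η) : lam 0 / (1 + η) ≤ blowupTime lam := by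
  have h1η : 0 < 1 + η := by linarith
  have hint := integrableOn_Ioi_of_modulation hcont hpos hderiv hη1 hη
  have hint' : IntegrableOn (fun s => lam 0 * Real.exp (-(1 + η) * s)) (Ioi 0) :=
    (exp_neg_integrableOn_Ioi 0 h1η).integrable.const_mul (lam 0)
  calc lam 0 / (1 + η) = ∫ s in Ioi (0 : ℝ), lam 0 * Real.exp (-(1 + η) * s) := by
        rw [MeasureTheory.integral_const_mul, integral_exp_mul_Ioi (by linarith) 0, mul_zero, Real.exp_zero]
        field_simp
    _ ≤ blowupTime lam :=
        setIntegral_mono_on hint' hint measurableSet_Ioi fun s hs =>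
          mul_exp_le_of_modulation hcont.continuousOn (fun s _ => hpos s) hderiv hη (le_of_lt hs)

/-- **`0 < T_*`.** [folklore] -/
theorem blowupTime_pos_of_modulation (hcont : Continuous lam) (hpos : ∀ s, 0 < lam s)
    (hderiv : ∀ s, 0 < s → HasDerivAt lam (lam' s) s) (hη1 : η < 1)
    (hη : ∀ s, 0 < s → |lam' s / lam s + 1| ≤ η) : 0 < blowupTime lam :=
  blowupTime_pos hcont hpos (integrableOn_Ioi_of_modulation hcont hpos hderiv hη1 hη)

/-- **From the stability theorem to the printed blow-up** ([ElgindiGhoulMasmoudi2021]: Thm 2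
⟹ Thm 1's `lim_{t → T_*} ∫₀ᵗ |ω(s)|_{L^∞} ds = +∞`, via Cor 2.2 / Remark 2.3 and (2.13)). Let
`λ > 0` be continuous, differentiable on `(0, ∞)` with `|λ_s/λ + 1| ≤ η < 1` there, let
`t(s) = ∫₀ˢ λ` be the physical time and `T_* = ∫₀^∞ λ` (finite, `integrableOn_Ioi_of_modulation`).
If a `[0, ∞]`-valued functional `N` of physical time obeys the rescaled lower bound
`m ≤ λ(s) N(t(s))` for `s > 0` with `m ≠ 0` (for `N(t) = ‖ω(t)‖_{L^∞}`: `λ(s)‖ω(t(s))‖_∞ =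
‖W(s)‖_∞ ≥ ‖F‖_∞ − ‖ε(s)‖_∞ ≥ m`), then `∫_{(0,t)} N → ∞` as `t ↑ T_*`. [cite: ElgindiGhoulMasmoudi2021, §2.5 Thm 2, Cor 2.2, Remark 2.3 (p. 9); §2.3 (2.13) (p. 8); §1.3 Thm 1 (p. 3)] -/
theorem tendsto_lintegral_of_modulation (hcont : Continuous lam) (hpos : ∀ s, 0 < lam s)
    (hderiv : ∀ s, 0 < s → HasDerivAt lam (lam' s) s) (hη1 : η < 1)
    (hη : ∀ s, 0 < s → |lam' s / lam s + 1| ≤ η) {N : ℝ → ℝ≥0∞} {m : ℝ≥0∞} (hm : m ≠ 0)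
    (hN : ∀ s, 0 < s → m ≤ ENNReal.ofReal (lam s) * N (rescaledTime lam s)) :
    Tendsto (fun t => ∫⁻ s in Ioo 0 t, N s) (𝓝[<] (blowupTime lam)) (𝓝 ∞) :=
  tendsto_lintegral_Ioo_nhdsLT_blowupTime hcont hpos
    (integrableOn_Ioi_of_modulation hcont hpos hderiv hη1 hη) hm hN

end Modulation

end Literature.Analysis.FluidPDE
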